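import Summits.BirchSwinnertonDyer.BirchSwinnertonDyer.Theses.VerticalContact
import Summits.BirchSwinnertonDyer.BirchSwinnertonDyer.Theorems.VerticalContactVerticalSelmerBoundStubSelmerLengthLB
import Literature.NumberTheory.EllipticCurves.Newforms
import Literature.NumberTheory.Automorphic.BrandtWeightKJacquetLanglands
import Literature.NumberTheory.Automorphic.BrandtDefiniteSetupLite

/-!
# Birth skeleton (BC3) for crux `VerticalSelmerBound` — item stmt-BirchSwinnertonDyer-18131, route VerticalContact (rev 4)

Registrar: planner-skel-stmt-BirchSwinnertonDyer-18131-0 (skeleton-register, 2026-08-17). Published as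
`Cruxes/VerticalSelmerBound/Lines/birth.lean`.

This is the layer-2 cut of the single open stub `stub_uniformToricControl` of the registered line
`Lines/toric_control.lean` (lead prover-line-stmt-BirchSwinnertonDyer-18432-c1-0; PROMOTE dossier
`Cruxes/VerticalSelmerBound/PROMOTE-stub_uniformToricControl.md`, §2 "F1 / F2∘F3 / C4 / G5"), typed over EXISTING
declarations only (no definition layer needed), into THREE named stubs plus the landed Selmer-length lower bound:

* `stub_jacquetLanglands` (F1 — Eichler's basis problem / Jacquet–Langlands in weight `k` for the INLINE Brandt
  eigen-system; known theorem, VENDORED as the named fact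
  `Literature.NumberTheory.Automorphic.jacquetLanglands_newform_of_brandtEigenformLite` (p163770, grounder g86-3,
  2026-08-17T13:39Z; DembeleVoight2013 Thm 33, JacquetLanglands1970 Thm 16.1, Eichler1973 Ch. II,
  HijikataPizerShemanske1989 §7, normalisation ChidaHsieh2016 §2.1/§6.1). The stub IS that fact BY NAME (discharge shape
  `theorem … : <named fact>`), so it cannot drift from the Literature statement and its closure is −1 named-fact debt
  (D-0026); the composition bridges the `Brandt.*Lite` packaging to the crux's inline `let`s (rfl-level: `rightIdealsLite`,
  `heckeNeighboursLite`, `coeffActionLite`, `DefiniteSetupLite` built from the crux's definite/Eichler clause;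
  `N⁺ ≠ 0` from `WeierstrassCurve.conductorNorm_pos_holds`). Content: a non-zero `Bˣ`-equivariant `Sym^(k-2)`-valued
  `T_q`-eigenfunction `Φ` on the invertible right ideals of an Eichler order `O` of level `N⁺` in the definite algebra
  `(a,b)_ℚ` of discriminant `N⁻` has the Hecke eigenvalues (`q ∤ N⁺N⁻`) of a classical newform `g ∈ S_k(Γ₀(N⁻M))`,
  `M ∣ N⁺`, under some embedding `σ : F → ℂ`.
* `stub_evalSupAttained` (G5, normalisation — genuine lemma, size M–L): the sup of `val (Φ(I)(w))` over `p`-trivial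
  invertible right `O`-ideals `I` (`PT I`) and `𝔓`-primitive vectors `w` (`PR w`) is ATTAINED at some `(I₀, e₀)`.
  Why true: `PT I ∧ PT (βI)` forces `β ∈ (O ⊗ ℤ_(p))ˣ`, so `ι β ∈ GL₂` is `𝔓`-integral with integral inverse and
  `w ↦ w·ι(β)` permutes primitive vectors, whence the value set `{val (Φ J w)}` is constant on `Bˣ`-orbits of
  `RI ∩ PT` (equivariance `Φ(βI) = ρ_β Φ(I)`, `eval w (ρ_β P) = eval (w ᵥ* ι β) P`); the orbits are finitely many
  (Jordan–Zassenhaus / finiteness of the class set of the order `O` — NOT in Mathlib for quaternion orders: this is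
  the stub's real content); on each orbit the values form a subset of `ℤₘ₀` bounded above by the Gauss norm of
  `Φ(I)`, hence have a maximum.
* `stub_congruentControl` (F2 ∘ F3 ∘ C4 — the deep, conjecture-strength core, uniform in the weight and in the
  coefficient datum): GIVEN the newform `g` of `stub_jacquetLanglands` (congruent to `f_E` modulo `𝔓^(N+1)` away from
  `Np` by the crux's congruence clause, `𝔓`-ordinary by `val (lam p) = 1`) and GIVEN a sup-normalising pair `(I₀, e₀)`,
  there is `j` with `val(P)² ≤ val(Φ(I₀)(e₀))²·val(p)^j` and `#Sel^(p^(N+1))(E/K) ≤ p^(j + C₂)`, `C₂` depending only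
  on the `F`-free data — i.e. `length Sel ≤ ord(θ_g(𝟙)) + O(1)` via Deligne–Carayol (`T_g/ϖ^(e(N+1)) ≅ T_pE/…`, tree:
  `NewformGaloisRep.exists_padicGaloisRep_of_isNewform1`, `CarayolSerreLemmas`), the E-local Kummer-vs-Greenberg Selmer
  comparison, the anticyclotomic IMC for `g` (CastellaKimLongo2017 Cor. 5.4 over BertoliniDarmon2005 / PollackWeston2011 /
  SkinnerUrban2014) with control at the trivial character, and the Chida–Hsieh / Castella–Longo interpolation
  `θ_g(𝟙) ≐ P(Φ)²/‖Φ‖²`. NOT in print: `C₂` independent of `k` (grounder g78-11; PROMOTE dossier Verdict).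
* landed: `Theorems.stub_selmerLengthLB` (p159065) — `p^(n·(corank E + corank E^(d_K))) ≤ #Sel^(p^n)(E/K)·p^c` — used BY NAME.

`VerticalSelmerBound_of` composes the three stubs (and the landed lower bound) into the route decl
`Summit.BirchSwinnertonDyer.BirchSwinnertonDyer.Theses.VerticalContact.VerticalSelmerBound` BY NAME, sorry-free:
JL supplies `g`, the sup stub supplies `(I₀, e₀)`, the control stub supplies `j` and `#Sel ≤ p^(j+C₂)`, and
`p^((N+1)s) ≤ #Sel·p^c` gives `(N+1)s ≤ j + (C₂ + c)`; so `C' := C₂ + c`.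

Vocabulary (v3). Stubs 2 and 3 are written over the tree's Mathlib-only inline Brandt dictionary
`Literature.NumberTheory.Automorphic.Brandt.*Lite` (`rightIdealsLite O` = the crux's `RI`, `IsCommensurablePrimeToLite O p` = `PT`,
`IsGrossPointLite O ψ` = `HG`, `IsRamifiedExactlyAtLite a b N⁻` / `IsEichlerOrderLite O N⁺` = the definite/Eichler clause,
`coeffActionLite ι` = `ρ`, `heckeNeighboursLite O q I` = the `T_q` index set — every one `rfl`-level with the crux's `let`s, cf. the
`*_iff`/`*_def` lemmas of `BrandtDefiniteSetupLite.lean`), so that (i) the composition below is still a chain of `exact`s (definitional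
unfolding only) and (ii) each registered one-line signature stays under the registry's 4000-character bound (the verbatim-inline
wording of stub 3 is 4192 characters). All other `let`s (`hK, dK, spl, L, val, PR`) are the crux's, binder for binder.

Disproof used (`Cruxes/VerticalSelmerBound/Disproof.lean`, cdisprove cycle 1; its §2/§4 targets are the RETIRED rev-1
type, its analysis of the intended = rev-4 statement stands): no `_false_without_` theorem exists for this crux (the
docblock says none is landable); the load-bearing hypotheses it identifies are honoured as follows — `val (lam p) = 1`
(ordinarity, load-bearing for the evaluation-sup NORMALISATION vs the Gauss norm) and the congruence clause sit inside
`stub_congruentControl`, which is also where `HasSurjectiveModNGaloisRep p` / `¬ p ∣ v_q(Δ)` (method-bearing: CKL/SU/PW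
hypotheses) are consumed; `2 < k` is consumed by `stub_jacquetLanglands` (no Eisenstein eigen-systems in weight > 2)
and by the control stub. No stub is an instance of the landed Negative lemmas `Theorems/VerticalSelmerBound/Negative/
WeightClause.lean` (`weightClause_offBranch`, `weightClause_offCharacter`): every stub keeps the rev-4 ON-BRANCH clause
`2(p-1)p^N·h_K ∣ k-2` verbatim (or does not mention weights at all), so the off-branch witnesses do not instantiate them.
-/

namespace Summit.BirchSwinnertonDyer.BirchSwinnertonDyer.Cruxes.VerticalSelmerBound.Birth

open scoped BigOperators Classical
open Summit.BirchSwinnertonDyer.BirchSwinnertonDyer.Theses.VerticalContact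

set_option linter.dupNamespace false
set_option linter.unusedVariables false

/-- **Stub 1 (F1 — the vendored Jacquet–Langlands / Eichler basis-problem fact in weight `k`, BY NAME).**
`Literature.NumberTheory.Automorphic.jacquetLanglands_newform_of_brandtEigenformLite` (p163770): for a definite set-up
`S : Brandt.DefiniteSetupLite N⁺ N⁻` (`a, b < 0`, ramified exactly at the primes of the squarefree `N⁻`, Eichler order
`S.O` of level `N⁺`), `N⁺ ≠ 0` coprime to `N⁻`, a splitting `ι`, `k > 2`, and a non-zero `Bˣ`-equivariant homogeneous
degree-`(k-2)` simultaneous `T_q`-eigenfunction `Φ` (`q ∤ N⁺N⁻`) on `Brandt.rightIdealsLite S.O` with eigenvalues `lam q`: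
`∃ M ∣ N⁺`, a newform `g ∈ S_k(Γ₀(N⁻M))` and `σ : F →+* ℂ` with `a_q(g) = σ (lam q)` for all primes `q ∤ N⁺N⁻`.
Discharge shape (`theorem … : <named fact>`, like `conductorNorm_pos_holds`): proving this stub = formalising JL
(DembeleVoight2013 Thm 33; JacquetLanglands1970 Thm 16.1; Eichler1973 Ch. II; HijikataPizerShemanske1989 §7). -/
theorem stub_jacquetLanglands :
    Literature.NumberTheory.Automorphic.jacquetLanglands_newform_of_brandtEigenformLite := by
  sorry

/-- **Stub 2 (G5, normalisation lemma).** The sup of the `𝔓`-adic sizes `val (Φ(I)(w))` over `p`-trivial invertible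
right `O`-ideals `I` and `𝔓`-primitive vectors `w` is attained. Content: finiteness of the `Bˣ`-orbits on `RI`
(Jordan–Zassenhaus for the order `O`; Reiner, *Maximal Orders*, Thm 26.4) + `PT I ∧ PT (βI) ⇒ β ∈ (O ⊗ ℤ_(p))ˣ`
+ integrality of `ι` on `O` (so `w ↦ w ᵥ* ι β` permutes primitive vectors) + discreteness of `ℤₘ₀` below the Gauss
norm of `Φ(I)`. Only "`O` is a `ℤ`-order in a quaternion algebra" is used from the definite/Eichler clause. -/
theorem stub_evalSupAttained :
    ∀ (p : ℕ) [Fact p.Prime] (Nplus Nminus : ℕ) (a b : ℚ), let B := QuaternionAlgebra ℚ a 0 b; ∀ (O : Subring B), let Λ := Submodule ℤ B; let RI : Set Λ := Literature.NumberTheory.Automorphic.Brandt.rightIdealsLite O; let PT : Λ → Prop := Literature.NumberTheory.Automorphic.Brandt.IsCommensurablePrimeToLite O p; (a < 0 ∧ b < 0 ∧ Literature.NumberTheory.Automorphic.Brandt.IsRamifiedExactlyAtLite a b Nminus ∧ Literature.NumberTheory.Automorphic.Brandt.IsEichlerOrderLite O Nplus) → ∀ (F : Type) [Field F] [NumberField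 F] (𝔓 : IsDedekindDomain.HeightOneSpectrum (NumberField.RingOfIntegers F)) (ι : B →ₐ[ℚ] Matrix (Fin 2) (Fin 2) F), let val := 𝔓.valuation F; let PR : (Fin 2 → F) → Prop := fun w => (∀ i, val (w i) ≤ 1) ∧ ∃ i, val (w i) = 1; let ρ : Bˣ → MvPolynomial (Fin 2) F → MvPolynomial (Fin 2) F := Literature.NumberTheory.Automorphic.Brandt.coeffActionLite ι; ((p : NumberField.RingOfIntegers F) ∈ 𝔓.asIdeal ∧ ∀ x ∈ O, ∀ i j, val (ι x i j) ≤ 1) → ∀ (k : ℕ) (Φ : Λ → MvPolynomial (Fin 2) F), (∀ I ∈ RI, (Φ I).IsHomogeneous (k - 2)) → (∀ (β : Bˣ), ∀ I ∈ RI, Φ (I.map (AddMonoidHom.mulLeft β.1).toIntLinearMap) = ρ β (Φ I)) → (∃ I ∈ RI, PT I) → ∃ I₀ ∈ RI, PT I₀ ∧ ∃ e₀ : Fin 2 → F, PR e₀ ∧ ∀ I ∈ RI, PT I → ∀ w : Fin 2 → F, PR w → val (MvPolynomial.eval w (Φ I)) ≤ val (MvPolynomial.eval e₀ (Φ I₀))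 := by
  sorry

/-- **Stub 3 (F2 ∘ F3 ∘ C4, deep — congruent vertical control, uniform in the weight and the coefficient datum).**
In the `F`-free data of the crux there is `C₂` such that for every coefficient datum, depth `N`, admissible
on-branch weight-`k` eigen-system `Φ` (same conjunction as the crux), every classical newform `g` realising its
eigenvalues away from `N⁺N⁻` (output of `stub_jacquetLanglands`) and every sup-normalising pair `(I₀, e₀)` (output of
`stub_evalSupAttained`): `∃ j, val(P)² ≤ val(Φ(I₀)(e₀))²·val(p)^j ∧ #Sel^(p^(N+1))(E/K) ≤ p^(j + C₂)`.
Route: Deligne–Carayol congruence of `T_g` and `T_pE` modulo `ϖ^(e(N+1))` (tree: `exists_padicGaloisRep_of_isNewform1`,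
`CarayolSerreLemmas`), E-local Kummer/Greenberg comparison, anticyclotomic IMC for `g` (CastellaKimLongo2017 Cor 5.4;
BertoliniDarmon2005, PollackWeston2011, SkinnerUrban2014) + control at `𝟙`, Chida–Hsieh/Castella–Longo interpolation.
NOT in print: `C₂` uniform in `k` (conjecture-strength; PROMOTE dossier). Honours Disproof.lean: uses `val (lam p) = 1`
(visibility of ordinary forms on primitive vectors) and the congruence clause; on-branch weight clause kept verbatim. -/
theorem stub_congruentControl :
    ∀ (W : WeierstrassCurve ℚ) [W.IsElliptic] [W.IsGloballyMinimal] (p : ℕ) [Fact p.Prime] (K : Type) [Field K] [NumberField K] (Nplus Nminus : ℕ) (a b : ℚ), let B := QuaternionAlgebra ℚ a 0 b; let R := NumberField.RingOfIntegers K; ∀ (O : Subring B) (ψ : K →ₐ[ℚ] B) (I₁ : Submodule ℤ B) (a₀ : ClassGroup R → nonZeroDivisors (Ideal R)) (α : ClassGroup R → R), let Λ := Submodule ℤ B; let hK := NumberField.classNumber K; let dK := NumberField.discr K; let spl : ℕ → ℕ := fun q => ((Ideal.span {(q : ℤ)}).primesOver R).ncard; let RI : Set Λ := Literature.NumberTheory.Automorphic.Brandt.rightIdealsLite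 O; let PT : Λ → Prop := Literature.NumberTheory.Automorphic.Brandt.IsCommensurablePrimeToLite O p; let L : ClassGroup R → Λ := fun c => Submodule.span ℤ ((fun x : R => ψ (x : K)) '' (a₀ c).1) * I₁; let HG : Λ → Prop := Literature.NumberTheory.Automorphic.Brandt.IsGrossPointLite O ψ; ((5 ≤ p ∧ W.HasGoodReductionAtPrime p ∧ ¬ (p : ℤ) ∣ W.frobeniusTrace p ∧ W.HasSurjectiveModNGaloisRep p ∧ ¬ p ∣ 6 * hK ∧ Int.gcd dK (W.conductorNorm ℤ * p) = 1) ∧ (Module.finrank ℚ K = 2 ∧ NumberField.IsTotallyComplex K ∧ dK < -4 ∧ spl p = 2) ∧ (W.conductorNorm ℤ = Nplus * Nminus ∧ Nat.Coprime Nplus Nminus ∧ Squarefree Nminus ∧ Odd Nminus.primeFactors.card ∧ (∀ q : ℕ, q.Prime → q ∣ Nplus → spl q = 2) ∧ (∀ q : ℕ, q.Prime → q ∣ Nminus → spl q = 1 ∧ ¬ (p : ℤ) ∣ padicValRat q W.Δ)) ∧ (a < 0 ∧ b < 0 ∧ Literature.NumberTheory.Automorphic.Brandt.IsRamifiedExactlyAtLite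 a b Nminus ∧ Literature.NumberTheory.Automorphic.Brandt.IsEichlerOrderLite O Nplus) ∧ (HG I₁ ∧ ∀ c, ClassGroup.mk0 (a₀ c) = c ∧ IsCoprime (a₀ c).1 (Ideal.span {(p : R)}) ∧ Ideal.span {α c} = (a₀ c).1 ^ hK ∧ HG (L c) ∧ PT (L c))) → ∃ C₂ : ℕ, ∀ (F : Type) [Field F] [NumberField F] [Algebra K F] (𝔓 : IsDedekindDomain.HeightOneSpectrum (NumberField.RingOfIntegers F)) (ι : B →ₐ[ℚ] Matrix (Fin 2) (Fin 2) F) (e e' : Fin 2 → F), let val := 𝔓.valuation F; let PR : (Fin 2 → F) → Prop := fun w => (∀ i, val (w i) ≤ 1) ∧ ∃ i, val (w i) = 1; let ρ : Bˣ → MvPolynomial (Fin 2) F → MvPolynomial (Fin 2) F := Literature.NumberTheory.Automorphic.Brandt.coeffActionLite ι; (((p : NumberField.RingOfIntegers F) ∈ 𝔓.asIdeal ∧ ∀ x ∈ O, ∀ i j, val (ι x i j) ≤ 1) ∧ ((∀ t, Matrix.vecMul e (ι (ψ t)) = (algebraMap K F t) • e) ∧ (∀ t, Matrix.vecMul e'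 (ι (ψ t)) = (algebraMap K F (Algebra.trace ℚ K t) - algebraMap K F t) • e') ∧ (∀ i, val (e i) ≤ 1) ∧ (∀ i, val (e' i) ≤ 1) ∧ val (e 0 * e' 1 - e 1 * e' 0) = 1)) → ∀ (N k : ℕ) (lam : ℕ → F) (Φ : Λ → MvPolynomial (Fin 2) F), ((2 < k ∧ 2 * (p - 1) * p ^ N ∣ k - 2 ∧ 2 * (p - 1) * p ^ N * hK ∣ k - 2) ∧ (∀ I ∈ RI, (Φ I).IsHomogeneous (k - 2)) ∧ (∀ (β : Bˣ), ∀ I ∈ RI, Φ (I.map (AddMonoidHom.mulLeft β.1).toIntLinearMap) = ρ β (Φ I)) ∧ (∀ q : ℕ, q.Prime → ¬ q ∣ Nplus * Nminus → ∀ I ∈ RI, ∑ᶠ J ∈ Literature.NumberTheory.Automorphic.Brandt.heckeNeighboursLite O q I, Φ J = lam q • Φ I) ∧ (∀ q : ℕ, q.Prime → ¬ q ∣ Nplus * Nminus * p → val (lam q - (W.frobeniusTrace q : F)) ≤ val (p : F) ^ (N + 1)) ∧ val (lam p) = 1 ∧ ∃ I ∈ RI, PT I ∧ Φ I ≠ 0)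 → ∀ (M : ℕ) [NeZero (Nminus * M)] (g : CuspForm (CongruenceSubgroup.Gamma0 (Nminus * M)) (k : ℤ)) (σ : F →+* ℂ), (M ∣ Nplus ∧ Literature.NumberTheory.EllipticCurves.ModularForms.IsNewform0 g ∧ ∀ q : ℕ, q.Prime → ¬ q ∣ Nplus * Nminus → (UpperHalfPlane.qExpansion 1 ⇑g).coeff q = σ (lam q)) → ∀ I₀ ∈ RI, PT I₀ → ∀ e₀ : Fin 2 → F, PR e₀ → (∀ I ∈ RI, PT I → ∀ w : Fin 2 → F, PR w → val (MvPolynomial.eval w (Φ I)) ≤ val (MvPolynomial.eval e₀ (Φ I₀))) → ∃ j : ℕ, val (∑ c, (algebraMap K F (α c : K))⁻¹ ^ ((k - 2) / hK) * MvPolynomial.eval e (Φ (L c))) ^ 2 ≤ val (MvPolynomial.eval e₀ (Φ I₀)) ^ 2 * val (p : F) ^ j ∧ Nat.card ↥((W.baseChange K).selmerGroup ((p : ℤ) ^ (N + 1))) ≤ p ^ (j + C₂) := by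
  sorry

namespace Statement

/-- The statement of `stub_jacquetLanglands`, by name (skeleton protocol: composition hypotheses are declared stubs). -/
abbrev stub_jacquetLanglands : Prop := type_of% @Birth.stub_jacquetLanglands
/-- The statement of `stub_evalSupAttained`, by name. -/
abbrev stub_evalSupAttained : Prop := type_of% @Birth.stub_evalSupAttained
/-- The statement of `stub_congruentControl`, by name. -/
abbrev stub_congruentControl : Prop := type_of% @Birth.stub_congruentControl

end Statement

/-- **Composition (BC3).** The three stubs give the route decl `VerticalSelmerBound` (item stmt-BirchSwinnertonDyer-18131)
BY NAME; the landed `Theorems.stub_selmerLengthLB` (p159065) is discharged inside; the vendored JL fact (stub 1) is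
applied to the `Brandt.DefiniteSetupLite` assembled from the crux's definite/Eichler clause (rfl-level bridge). `C' := C₂ + c`. -/
theorem VerticalSelmerBound_of (hJL : Statement.stub_jacquetLanglands) (hSup : Statement.stub_evalSupAttained)
    (hCtl : Statement.stub_congruentControl) :
    Summit.BirchSwinnertonDyer.BirchSwinnertonDyer.Theses.VerticalContact.VerticalSelmerBound := by
  intro W _ _ p _ K _ _ Nplus Nminus a b B R O ψ I₁ a₀ α Λ hK dK spl RI PT L HG hFree
  have hp : p.Prime := Fact.out
  obtain ⟨c, hc⟩ :=
    Summit.BirchSwinnertonDyer.BirchSwinnertonDyer.Theorems.stub_selmerLengthLB W p K hFree.2.1.1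
  obtain ⟨C₂, hC₂⟩ := hCtl W p K Nplus Nminus a b O ψ I₁ a₀ α hFree
  refine ⟨C₂ + c, ?_⟩
  intro F _ _ _ 𝔓 ι e e' val PR ρ hFdep N k lam Φ hForm
  -- F1: the classical newform behind `Φ` — the vendored JL fact applied to the inline definite set-up
  have hNplus : Nplus ≠ 0 := by
    have hN : 0 < W.conductorNorm ℤ := W.conductorNorm_pos_holds
    intro h0
    rw [hFree.2.2.1.1, h0, zero_mul] at hN
    exact lt_irrefl 0 hN
  obtain ⟨hDa, hDb, hDram, hDeich⟩ := hFree.2.2.2.1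
  let S : Literature.NumberTheory.Automorphic.Brandt.DefiniteSetupLite Nplus Nminus :=
    ⟨a, b, O, hDa, hDb, hDram, hFree.2.2.1.2.2.1, hDeich⟩
  obtain ⟨M, instM, g, σ, hg⟩ := hJL Nplus Nminus S F ι k lam Φ hNplus hFree.2.2.1.2.1 hForm.1.1
    hForm.2.1 hForm.2.2.1 hForm.2.2.2.1
    (by obtain ⟨I, hI, -, hne⟩ := hForm.2.2.2.2.2.2; exact ⟨I, hI, hne⟩)
  -- G5: a sup-normalising pair
  obtain ⟨I₀, hI₀, hPT₀, e₀, he₀, hmax⟩ := hSup p Nplus Nminus a b O hFree.2.2.2.1 F 𝔓 ι hFdep.1 k Φ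
    hForm.2.1 hForm.2.2.1 (by obtain ⟨I, hI, hPT, -⟩ := hForm.2.2.2.2.2.2; exact ⟨I, hI, hPT⟩)
  -- C4: congruent control at the normalising pair
  haveI : NeZero (Nminus * M) := instM
  obtain ⟨j, hineq, hcard⟩ := hC₂ F 𝔓 ι e e' hFdep N k lam Φ hForm M g σ hg I₀ hI₀ hPT₀ e₀ he₀ hmax
  refine ⟨I₀, hI₀, hPT₀, e₀, he₀, j, hineq, ?_⟩
  have hpow : p ^ ((N + 1) * (W.selmerCorank p + (W.quadraticTwist (dK : ℚ)).selmerCorank p)) ≤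
      p ^ (j + C₂ + c) := by
    calc p ^ ((N + 1) * (W.selmerCorank p + (W.quadraticTwist (dK : ℚ)).selmerCorank p))
        ≤ Nat.card ↥((W.baseChange K).selmerGroup ((p : ℤ) ^ (N + 1))) * p ^ c := hc (N + 1)
      _ ≤ p ^ (j + C₂) * p ^ c := Nat.mul_le_mul_right _ hcard
      _ = p ^ (j + C₂ + c) := by rw [← pow_add]
  have hle := (Nat.pow_le_pow_iff_right hp.one_lt).mp hpow
  omega

end Summit.BirchSwinnertonDyer.BirchSwinnertonDyer.Cruxes.VerticalSelmerBound.Birth
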